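import Literature.Geometry.Riemannian.MetricFlowHeatFlow
import Literature.Geometry.Riemannian.MetricFlowConcentration
import Mathlib.Probability.Kernel.MeasurableLIntegral
import HarnessLib

/-!
# The variance of mixtures, and the monotonicity of `Var + Ht` along conjugate heat flows of an
# `H`-concentrated metric flow (Bamler 2023, §2.2 and §3.4, Proposition after the Definition of
# `H`-concentration)

R. Bamler, *Compactness theory of the space of super Ricci flows*, Invent. Math. 233 (2023).
§2.2 (after Definition (Variance)): "if `(Y, ν), (Y', ν')` are probability spaces and
`(μ_s ∈ 𝒫(X))_{s ∈ Y}`, `(μ'_{s'} ∈ 𝒫(X'))_{s' ∈ Y'}` are integrable families of probability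
measures, then `Var(∫_Y μ_s dν(s), ∫_{Y'} μ'_{s'} dν'(s')) = ∫_Y ∫_{Y'} Var(μ_s, μ'_{s'}) dν(s) dν'(s')`."
§3.4, Proposition: "If `𝒳` is `H`-concentrated, then for any two conjugate heat flows
`(μ¹_t)_{t ∈ I'}, (μ²_t)_{t ∈ I'}`, `I' ⊂ I`, the function `t ↦ Var(μ¹_t, μ²_t) + Ht`, `t ∈ I'` is
non-decreasing. … Moreover, for fixed `t ∈ I`, `x₁, x₂ ∈ 𝒳_t` the following function is
non-decreasing `s ↦ Var(ν_{x₁;s}, ν_{x₂;s}) + H(t − s)`, `s ≤ t`. Proof. Let `s' ≤ s'' ≤ t`. By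
Definition (conjugate heat flow) we have `Var(μ_{s'}, μ_{s'}) = ∫∫ Var(ν_{y₁;s'}, ν_{y₂;s'})
dμ_{s''}(y₁) dμ_{s''}(y₂) ≤ ∫∫ (d²_{s''}(y₁, y₂) + H(s'' − s')) dμ_{s''}(y₁) dμ_{s''}(y₂) =
Var(μ_{s''}, μ_{s''}) + H(s'' − s')`."

This file PROVES both statements over `MetricFlow.lean`, `MetricFlowHeatFlow.lean` (the
conjugate heat kernels as Markov kernels `MetricFlow.kernel`, conjugate heat flows as compositions)
and `MetricFlowConcentration.lean` (`variance`, `IsHConcentrated`), for measurable families of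
measures in the form of Mathlib's kernels:

* `variance_comp_comp` — **`Var(κ₁ ∘ₘ μ₁, κ₂ ∘ₘ μ₂) = ∫∫ Var(κ₁(y₁), κ₂(y₂)) dμ₁(y₁) dμ₂(y₂)`**
  (the mixture formula; `Measure.bind`, Tonelli);
* `MetricFlow.IsHConcentrated.variance_le_variance_add` — **the Proposition for conjugate heat
  flows**: `Var(μ¹_s, μ²_s) ≤ Var(μ¹_t, μ²_t) + H(t − s)` for `s ≤ t` in `I'`;
* `MetricFlow.IsHConcentrated.variance_condKernel_le_variance_condKernel_add` — **its second
  statement**: `Var(ν_{x₁;s'}, ν_{x₂;s'}) ≤ Var(ν_{x₁;s''}, ν_{x₂;s''}) + H(s'' − s')` for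
  `s' ≤ s'' ≤ t`.

No definitions, no named facts.

## References

* R. H. Bamler, *Compactness theory of the space of super Ricci flows*, Invent. Math. 233 (2023),
  1121–1277 (arXiv:2008.09298), §2.2 (display on mixtures after Definition (Variance)); §3.4,
  Proposition after Definition (`H`-Concentration) and its proof. [Bamler2023]
-/

noncomputable section

open Set MeasureTheory ProbabilityTheory Filter TopologicalSpace Function
open scoped Topology ENNReal NNReal ProbabilityTheory

namespace Literature.Geometry.Riemannian

/-! ### The variance of mixtures -/

section Mixture

variable {X : Type*} [MetricSpace X] [MeasurableSpace X] [BorelSpace X] [SeparableSpace X]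
  {Y₁ Y₂ : Type*} [MeasurableSpace Y₁] [MeasurableSpace Y₂]

/-- `(x₁, x₂) ↦ d(x₁, x₂)²` is measurable on a separable metric space. [folklore] -/
theorem measurable_edist_sq : Measurable fun p : X × X ↦ edist p.1 p.2 ^ 2 := by
  haveI : SecondCountableTopology X := UniformSpace.secondCountable_of_separable X
  exact measurable_edist.pow_const 2

/-- **The variance of mixtures** (Bamler 2023, §2.2, display after Definition (Variance):
"`Var(∫_Y μ_s dν(s), ∫_{Y'} μ'_{s'} dν'(s')) = ∫_Y ∫_{Y'} Var(μ_s, μ'_{s'}) dν(s) dν'(s')`"): for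
finite kernels `κ₁ : Y₁ ⇝ X`, `κ₂ : Y₂ ⇝ X` (measurable families of measures) and s-finite `μ₁`, `μ₂`,
`Var(κ₁ ∘ₘ μ₁, κ₂ ∘ₘ μ₂) = ∫∫ Var(κ₁ y₁, κ₂ y₂) dμ₂(y₂) dμ₁(y₁)` (all `lintegral`s; `Measure.bind`
and Tonelli). [cite: Bamler2023, §2.2, display after Definition (Variance)] -/
theorem variance_comp_comp (κ₁ : Kernel Y₁ X) (κ₂ : Kernel Y₂ X) [IsFiniteKernel κ₁]
    [IsFiniteKernel κ₂] (μ₁ : Measure Y₁) (μ₂ : Measure Y₂) [SFinite μ₁] [SFinite μ₂] :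
    variance (κ₁ ∘ₘ μ₁) (κ₂ ∘ₘ μ₂) =
      ∫⁻ y₁, ∫⁻ y₂, variance (κ₁ y₁) (κ₂ y₂) ∂μ₂ ∂μ₁ := by
  haveI : SecondCountableTopology X := UniformSpace.secondCountable_of_separable X
  have hd : Measurable fun p : X × X ↦ edist p.1 p.2 ^ 2 := measurable_edist_sq
  -- the inner integral against `κ₂ ∘ₘ μ₂`
  have hinner : ∀ x₁ : X, ∫⁻ x₂, edist x₁ x₂ ^ 2 ∂(κ₂ ∘ₘ μ₂) =
      ∫⁻ y₂, ∫⁻ x₂, edist x₁ x₂ ^ 2 ∂κ₂ y₂ ∂μ₂ := fun x₁ ↦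
    Measure.lintegral_bind κ₂.aemeasurable
      ((hd.comp (measurable_const.prodMk measurable_id)).aemeasurable)
  -- `G (x₁, y₂) := ∫ d²(x₁, ·) dκ₂(y₂)` is jointly measurable
  have hG : Measurable fun p : X × Y₂ ↦ ∫⁻ x₂, edist p.1 x₂ ^ 2 ∂κ₂ p.2 := by
    have := Measurable.lintegral_kernel_prod_right (κ := κ₂.comap Prod.snd measurable_snd)
      (f := fun (p : X × Y₂) (x₂ : X) ↦ edist p.1 x₂ ^ 2)
      (hd.comp ((measurable_fst.comp measurable_fst).prodMk measurable_snd))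
    simpa [Kernel.comap_apply] using this
  -- `F x₁ := ∫ G(x₁, y₂) dμ₂(y₂)` is measurable
  have hF : Measurable fun x₁ : X ↦ ∫⁻ y₂, ∫⁻ x₂, edist x₁ x₂ ^ 2 ∂κ₂ y₂ ∂μ₂ :=
    hG.lintegral_prod_right'
  rw [variance_def]
  simp_rw [hinner]
  rw [Measure.lintegral_bind κ₁.aemeasurable hF.aemeasurable]
  refine lintegral_congr fun y₁ ↦ ?_
  -- swap `∫ dκ₁(y₁)` and `∫ dμ₂`
  rw [lintegral_lintegral_swap (μ := κ₁ y₁) (ν := μ₂)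
    (f := fun (x : X) (y₂ : Y₂) ↦ ∫⁻ x₂, edist x x₂ ^ 2 ∂κ₂ y₂) hG.aemeasurable]
  rfl

end Mixture

/-! ### Monotonicity of `Var + Ht` (§3.4, Proposition) -/

namespace MetricFlow

universe u

variable {I : Set ℝ} {𝒳 : MetricFlow.{u} I} {H : ℝ}

/-- The core estimate of the proof of the Proposition: for `s ≤ t` in `I` and probability
measures `μ¹, μ²` on `𝒳_t`, `H`-concentration gives
`Var(ν_{·;s} ∘ₘ μ¹, ν_{·;s} ∘ₘ μ²) ≤ Var(μ¹, μ²) + H(t − s)`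
("`= ∫∫ Var(ν_{y₁;s}, ν_{y₂;s}) dμ(y₁)dμ(y₂) ≤ ∫∫ (d²_t(y₁,y₂) + H(t − s)) dμ dμ = Var(μ, μ) + H(t−s)`").
[cite: Bamler2023, §3.4, proof of the Proposition after Definition (H-Concentration)] -/
theorem IsHConcentrated.variance_comp_le (hH : 𝒳.IsHConcentrated H) {s t : I} (hst : (s : ℝ) ≤ t)
    (μ₁ μ₂ : Measure (𝒳.Slice t)) [IsProbabilityMeasure μ₁] [IsProbabilityMeasure μ₂] :
    variance (𝒳.kernel hst ∘ₘ μ₁) (𝒳.kernel hst ∘ₘ μ₂) ≤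
      variance μ₁ μ₂ + ENNReal.ofReal (H * ((t : ℝ) - s)) := by
  rw [variance_comp_comp, variance_def]
  calc ∫⁻ y₁, ∫⁻ y₂, variance (𝒳.kernel hst y₁) (𝒳.kernel hst y₂) ∂μ₂ ∂μ₁
      ≤ ∫⁻ y₁, ∫⁻ y₂, (edist y₁ y₂ ^ 2 + ENNReal.ofReal (H * ((t : ℝ) - s))) ∂μ₂ ∂μ₁ :=
        lintegral_mono fun y₁ ↦ lintegral_mono fun y₂ ↦ hH hst y₁ y₂
    _ = ∫⁻ y₁, ((∫⁻ y₂, edist y₁ y₂ ^ 2 ∂μ₂) + ENNReal.ofReal (H * ((t : ℝ) - s))) ∂μ₁ := by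
        refine lintegral_congr fun y₁ ↦ ?_
        rw [lintegral_add_right _ measurable_const, lintegral_const, measure_univ, mul_one]
    _ = (∫⁻ y₁, ∫⁻ y₂, edist y₁ y₂ ^ 2 ∂μ₂ ∂μ₁) + ENNReal.ofReal (H * ((t : ℝ) - s)) := by
        rw [lintegral_add_right _ measurable_const, lintegral_const, measure_univ, mul_one]

/-- **Monotonicity of `t ↦ Var(μ¹_t, μ²_t) + Ht` along conjugate heat flows** (Bamler 2023, §3.4,
Proposition after Definition (`H`-Concentration), first statement): if `𝒳` is `H`-concentrated
and `μ¹, μ²` are conjugate heat flows over `I'`, then for `s ≤ t` in `I'`,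
`Var(μ¹_s, μ²_s) ≤ Var(μ¹_t, μ²_t) + H(t − s)` (so `Var(μ¹_t, μ²_t) + Ht` is non-decreasing, and
`Var(μ¹_t, μ²_t) < ∞` propagates backwards). Proof: `μ^i_s = ν_{·;s} ∘ₘ μ^i_t`
(`IsConjugateHeatFlow.eq_conjugateHeatFlowOf`) and `variance_comp_le`.
[cite: Bamler2023, §3.4, Proposition after Definition (H-Concentration)] -/
theorem IsHConcentrated.variance_le_variance_add (hH : 𝒳.IsHConcentrated H) {I' : Set ℝ}
    {μ₁ μ₂ : ∀ t : I, Measure (𝒳.Slice t)} (h₁ : 𝒳.IsConjugateHeatFlow I' μ₁)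
    (h₂ : 𝒳.IsConjugateHeatFlow I' μ₂) {s t : I} (hs : (s : ℝ) ∈ I') (ht : (t : ℝ) ∈ I')
    (hst : (s : ℝ) ≤ t) :
    variance (μ₁ s) (μ₂ s) ≤ variance (μ₁ t) (μ₂ t) + ENNReal.ofReal (H * ((t : ℝ) - s)) := by
  haveI := h₁.1 t ht
  haveI := h₂.1 t ht
  rw [h₁.eq_conjugateHeatFlowOf 𝒳 ht hs hst, h₂.eq_conjugateHeatFlowOf 𝒳 ht hs hst,
    𝒳.conjugateHeatFlowOf_of_le t (μ₁ t) hst, 𝒳.conjugateHeatFlowOf_of_le t (μ₂ t) hst]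
  exact hH.variance_comp_le hst (μ₁ t) (μ₂ t)

/-- **Monotonicity of `s ↦ Var(ν_{x₁;s}, ν_{x₂;s}) + H(t − s)`** (same Proposition, second
statement): for `x₁, x₂ ∈ 𝒳_t` and `s' ≤ s'' ≤ t` in `I`,
`Var(ν_{x₁;s'}, ν_{x₂;s'}) ≤ Var(ν_{x₁;s''}, ν_{x₂;s''}) + H(s'' − s')` (reproduction formula
`ν_{x;s'} = ν_{·;s'} ∘ₘ ν_{x;s''}` and `variance_comp_le`). In particular (`s'' = t`) the defining
inequality of `H`-concentration. [cite: Bamler2023, §3.4, Proposition after Definition (H-Concentration)] -/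
theorem IsHConcentrated.variance_condKernel_le_variance_condKernel_add (hH : 𝒳.IsHConcentrated H)
    {s' s'' t : I} (h' : (s' : ℝ) ≤ s'') (h'' : (s'' : ℝ) ≤ t) (x₁ x₂ : 𝒳.Slice t) :
    variance (𝒳.condKernel x₁ s') (𝒳.condKernel x₂ s') ≤
      variance (𝒳.condKernel x₁ s'') (𝒳.condKernel x₂ s'') +
        ENNReal.ofReal (H * ((s'' : ℝ) - s')) := by
  haveI := 𝒳.isProbabilityMeasure_condKernel x₁ h''
  haveI := 𝒳.isProbabilityMeasure_condKernel x₂ h''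
  rw [𝒳.condKernel_eq_comp h' h'' x₁, 𝒳.condKernel_eq_comp h' h'' x₂]
  exact hH.variance_comp_le h' _ _

end MetricFlow

end Literature.Geometry.Riemannian

end
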